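import Mathlib

/-!
# One cut of high rank — lemmas II: signs and the class estimate (Cauchy–Schwarz)

Helper file for the stub `stub_oneCutKatai` of the crux `MobiusLadder.QuadraticDigitPhases`
(stmt-QuantumAdvantage-1391), line `Sketch`.

* `sign_add`, `sign_sum`, `sign_dotProduct` — bookkeeping for `(-1)^e`, `e : ZMod 2`, in the
  `if e = 1 then -1 else 1` encoding; `(-1)^{⟨u, α⟩}` is the Walsh product over `supp α`;
* `class_sq_bound` — THE CLASS ESTIMATE: on one carry class `I = [a, b)`, `b ≤ 2^c`, the square of
  `Σ_{T₀ ∈ I} |Σ_{T < T_max} s(T) (-1)^{⟨u₀(T₀), Bc U(T)⟩ + ⟨v₀(T₀), Bc V(T)⟩}|` is at most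
  `2^c · 2^c · (T_max² δ + T_max (w r + 1)^w 2^{d-r})`, `r = rank Bc`, given the Walsh–dilation bound
  `δ 2^c` for masks of joint size `≥ w` (good pairs `(T, T')`) and the sparse-image count for the bad
  pairs (through the injective map `T ↦ U T`).  Elementary (folklore).
-/

set_option linter.dupNamespace false -- D-0017: single-problem summit ⇒ QuantumAdvantage.QuantumAdvantage by design

namespace Summit.QuantumAdvantage.QuantumAdvantage.Theorems.MobiusLadderQuadraticDigitPhasesStubOneCutKatai

open Finset

/-- `(-1)^(e+f) = (-1)^e (-1)^f`. -/
theorem sign_add (e f : ZMod 2) :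
    (if e + f = 1 then (-1 : ℝ) else 1) =
      (if e = 1 then (-1 : ℝ) else 1) * (if f = 1 then (-1 : ℝ) else 1) := by
  have key : ∀ u : ZMod 2, u = 0 ∨ u = 1 := by decide
  have h11 : (1 : ZMod 2) + 1 = 0 := by decide
  rcases key e with rfl | rfl <;> rcases key f with rfl | rfl <;> simp [h11]

/-- `(-1)^(Σ e_i) = ∏ (-1)^(e_i)`. -/
theorem sign_sum {ι : Type*} (s : Finset ι) (f : ι → ZMod 2) :
    (if ∑ i ∈ s, f i = 1 then (-1 : ℝ) else 1) = ∏ i ∈ s, (if f i = 1 then (-1 : ℝ) else 1) := by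
  classical
  induction s using Finset.induction_on with
  | empty => simp
  | insert a s ha ih => rw [Finset.sum_insert ha, Finset.prod_insert ha, sign_add, ih]

/-- `|(-1)^e| = 1`. -/
theorem abs_sign (e : ZMod 2) : |(if e = 1 then (-1 : ℝ) else 1)| = 1 := by
  split_ifs <;> simp

/-- `(-1)^𝟙[b] = (if b then -1 else 1)`. -/
theorem sign_ite (b : Bool) :
    (if (if b then (1 : ZMod 2) else 0) = 1 then (-1 : ℝ) else 1) = if b then (-1 : ℝ) else 1 := by
  cases b <;> simp

/-- `(Σ_{i∈s} |g i|)² ≤ |s| Σ_{i∈s} (g i)²`. -/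
theorem sq_sum_abs_le (s : Finset ℕ) (g : ℕ → ℝ) :
    (∑ i ∈ s, |g i|) ^ 2 ≤ (s.card : ℝ) * ∑ i ∈ s, (g i) ^ 2 := by
  have h := sq_sum_le_card_mul_sum_sq (s := s) (f := fun i => |g i|)
  simpa only [sq_abs] using h

/-- `(-1)^{⟨u, α⟩} = ∏_{i : α i ≠ 0} (-1)^{u i}` over `ZMod 2`. -/
theorem sign_dotProduct {c : ℕ} (u α : Fin c → ZMod 2) :
    (if u ⬝ᵥ α = 1 then (-1 : ℝ) else 1) =
      ∏ i ∈ univ.filter (fun i => α i ≠ 0), (if u i = 1 then (-1 : ℝ) else 1) := by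
  have key : ∀ t : ZMod 2, t ≠ 0 → t = 1 := by decide
  have hdot : u ⬝ᵥ α = ∑ i ∈ univ.filter (fun i => α i ≠ 0), u i := by
    rw [dotProduct, Finset.sum_filter]
    refine Finset.sum_congr rfl fun i _ => ?_
    by_cases h : α i = 0
    · simp [h]
    · rw [if_pos h, key _ h, mul_one]
  rw [hdot, sign_sum]

/-- THE CLASS ESTIMATE (one carry class `I = [a,b)`, `b ≤ 2^c`): `|·|` in `T₀` followed by Cauchy–Schwarz
over `T₀ ∈ I`; the expanded square is a sum over pairs `(T,T')` of Walsh–dilation correlations with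
masks `supp Bc(U T + U T')`, `supp Bc(V T + V T')`, bounded by `δ 2^c` on good pairs (`hDWDc`) and
trivially on the bad pairs, which are counted by `hCountc` through the injective map `T ↦ U T`. -/
theorem class_sq_bound {c d : ℕ} (Bc : Matrix (Fin c) (Fin d) (ZMod 2)) (p q : ℕ) {δ : ℝ}
    (hδ : 0 ≤ δ) (w : ℕ)
    (hDWDc : ∀ A B : Finset (Fin c), w ≤ (A ∪ B).card → ∀ a b : ℕ, b ≤ 2 ^ c →
      |∑ T ∈ Ico a b, (∏ i ∈ A, (if Nat.testBit (p * T) i then (-1 : ℝ) else 1)) *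
          (∏ i ∈ B, (if Nat.testBit (q * T) i then (-1 : ℝ) else 1))| ≤ δ * (2 : ℝ) ^ c)
    (hCountc : ∀ S : Finset (Fin d → ZMod 2),
      (((S ×ˢ S).filter (fun xy =>
          ((Finset.univ.filter fun i : Fin c => (Bc.mulVec (xy.1 - xy.2)) i ≠ 0).card < w))).card : ℝ) ≤
        S.card * ((w * Bc.rank + 1 : ℕ) : ℝ) ^ w * (2 : ℝ) ^ (d - Bc.rank))
    {a b : ℕ} (hb : b ≤ 2 ^ c) (Tm : ℕ) (U V : ℕ → Fin d → ZMod 2)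
    (hU : ∀ T ∈ range Tm, ∀ T' ∈ range Tm, U T = U T' → T = T')
    (s : ℕ → ℝ) (hs : ∀ T, |s T| ≤ 1)
    (u₀ v₀ : ℕ → Fin c → ZMod 2)
    (hu₀ : ∀ T₀ i, u₀ T₀ i = if Nat.testBit (p * T₀) i then 1 else 0)
    (hv₀ : ∀ T₀ i, v₀ T₀ i = if Nat.testBit (q * T₀) i then 1 else 0)
    (g : ℕ → ℝ)
    (hg : ∀ T₀, g T₀ = ∑ T ∈ range Tm, s T *
      (if u₀ T₀ ⬝ᵥ Bc.mulVec (U T) + v₀ T₀ ⬝ᵥ Bc.mulVec (V T) = 1 then (-1 : ℝ) else 1)) :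
    (∑ T₀ ∈ Ico a b, |g T₀|) ^ 2 ≤
      (2 : ℝ) ^ c * ((2 : ℝ) ^ c * ((Tm : ℝ) ^ 2 * δ +
        Tm * ((w * Bc.rank + 1 : ℕ) : ℝ) ^ w * (2 : ℝ) ^ (d - Bc.rank))) := by
  classical
  -- notation
  set I : Finset ℕ := Ico a b with hI
  set sg : ZMod 2 → ℝ := fun e => if e = 1 then (-1 : ℝ) else 1 with hsg
  set K : (Fin d → ZMod 2) → (Fin d → ZMod 2) → ℝ := fun ξ ζ =>
    ∑ T₀ ∈ I, sg (u₀ T₀ ⬝ᵥ Bc.mulVec ξ + v₀ T₀ ⬝ᵥ Bc.mulVec ζ) with hK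
  set Aset : (Fin d → ZMod 2) → Finset (Fin c) :=
    fun ξ => univ.filter (fun i => Bc.mulVec ξ i ≠ 0) with hA
  have hIcard : (I.card : ℝ) ≤ (2 : ℝ) ^ c := by
    rw [hI, Nat.card_Ico]
    exact_mod_cast (Nat.sub_le b a).trans hb
  -- Walsh form of K
  have hKwalsh : ∀ ξ ζ, K ξ ζ = ∑ T₀ ∈ I,
      (∏ i ∈ Aset ξ, (if Nat.testBit (p * T₀) i then (-1 : ℝ) else 1)) *
      (∏ i ∈ Aset ζ, (if Nat.testBit (q * T₀) i then (-1 : ℝ) else 1)) := by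
    intro ξ ζ
    refine Finset.sum_congr rfl fun T₀ _ => ?_
    simp only [hsg]
    rw [sign_add, sign_dotProduct, sign_dotProduct]
    congr 1
    · refine Finset.prod_congr rfl fun i _ => ?_
      rw [hu₀, sign_ite]
    · refine Finset.prod_congr rfl fun i _ => ?_
      rw [hv₀, sign_ite]
  -- bounds on K
  have hKgood : ∀ ξ ζ, w ≤ (Aset ξ).card → |K ξ ζ| ≤ δ * (2 : ℝ) ^ c := by
    intro ξ ζ hw
    rw [hKwalsh]
    exact hDWDc (Aset ξ) (Aset ζ) (hw.trans (Finset.card_le_card Finset.subset_union_left)) a b hb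
  have hKtriv : ∀ ξ ζ, |K ξ ζ| ≤ (2 : ℝ) ^ c := by
    intro ξ ζ
    refine (Finset.abs_sum_le_sum_abs _ _).trans ?_
    refine le_trans (Finset.sum_le_sum (fun T₀ _ => (abs_sign _).le)) ?_
    simp only [Finset.sum_const, nsmul_eq_mul, mul_one]
    exact hIcard
  -- expand the square
  have hexpand : ∑ T₀ ∈ I, g T₀ ^ 2 =
      ∑ T ∈ range Tm, ∑ T' ∈ range Tm, s T * s T' * K (U T + U T') (V T + V T') := by
    have hprod : ∀ T T' T₀, sg (u₀ T₀ ⬝ᵥ Bc.mulVec (U T) + v₀ T₀ ⬝ᵥ Bc.mulVec (V T)) *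
        sg (u₀ T₀ ⬝ᵥ Bc.mulVec (U T') + v₀ T₀ ⬝ᵥ Bc.mulVec (V T')) =
        sg (u₀ T₀ ⬝ᵥ Bc.mulVec (U T + U T') + v₀ T₀ ⬝ᵥ Bc.mulVec (V T + V T')) := by
      intro T T' T₀
      simp only [hsg]
      rw [← sign_add]
      congr 1
      simp only [Matrix.mulVec_add, dotProduct_add]
      ring
    calc ∑ T₀ ∈ I, g T₀ ^ 2
        = ∑ T₀ ∈ I, ∑ T ∈ range Tm, ∑ T' ∈ range Tm,
            (s T * sg (u₀ T₀ ⬝ᵥ Bc.mulVec (U T) + v₀ T₀ ⬝ᵥ Bc.mulVec (V T))) *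
            (s T' * sg (u₀ T₀ ⬝ᵥ Bc.mulVec (U T') + v₀ T₀ ⬝ᵥ Bc.mulVec (V T'))) := by
          refine Finset.sum_congr rfl fun T₀ _ => ?_
          rw [hg, sq, Finset.sum_mul_sum]
      _ = ∑ T ∈ range Tm, ∑ T' ∈ range Tm, ∑ T₀ ∈ I,
            (s T * sg (u₀ T₀ ⬝ᵥ Bc.mulVec (U T) + v₀ T₀ ⬝ᵥ Bc.mulVec (V T))) *
            (s T' * sg (u₀ T₀ ⬝ᵥ Bc.mulVec (U T') + v₀ T₀ ⬝ᵥ Bc.mulVec (V T'))) := by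
          rw [Finset.sum_comm]
          refine Finset.sum_congr rfl fun T _ => ?_
          rw [Finset.sum_comm]
      _ = _ := by
          refine Finset.sum_congr rfl fun T _ => Finset.sum_congr rfl fun T' _ => ?_
          rw [hK, Finset.mul_sum]
          refine Finset.sum_congr rfl fun T₀ _ => ?_
          rw [← hprod]
          ring
  -- bad pairs
  set Pairs : Finset (ℕ × ℕ) := range Tm ×ˢ range Tm with hPairs
  set bad : Finset (ℕ × ℕ) := Pairs.filter (fun TT : ℕ × ℕ => (Aset (U TT.1 + U TT.2)).card < w)
    with hbad
  have hbadcard : (bad.card : ℝ) ≤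
      Tm * ((w * Bc.rank + 1 : ℕ) : ℝ) ^ w * (2 : ℝ) ^ (d - Bc.rank) := by
    set S : Finset (Fin d → ZMod 2) := (range Tm).image U with hS
    set Ψ : ℕ × ℕ → (Fin d → ZMod 2) × (Fin d → ZMod 2) := fun TT => (U TT.1, U TT.2) with hΨ
    have hinj : Set.InjOn Ψ bad := by
      rintro ⟨T₁, T₁'⟩ h₁ ⟨T₂, T₂'⟩ h₂ heq
      simp only [hΨ, Prod.mk.injEq] at heq
      have h₁' := (Finset.mem_filter.mp (Finset.mem_coe.mp h₁)).1
      have h₂' := (Finset.mem_filter.mp (Finset.mem_coe.mp h₂)).1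
      rw [hPairs, Finset.mem_product] at h₁' h₂'
      exact Prod.ext (hU _ h₁'.1 _ h₂'.1 heq.1) (hU _ h₁'.2 _ h₂'.2 heq.2)
    have hsub : bad.image Ψ ⊆ (S ×ˢ S).filter (fun xy =>
        ((Finset.univ.filter fun i : Fin c => (Bc.mulVec (xy.1 - xy.2)) i ≠ 0).card < w)) := by
      intro xy hxy
      obtain ⟨⟨T, T'⟩, hTT, rfl⟩ := Finset.mem_image.mp hxy
      rw [Finset.mem_filter] at hTT ⊢
      obtain ⟨hTT1, hTT2⟩ := hTT
      rw [hPairs, Finset.mem_product] at hTT1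
      refine ⟨Finset.mem_product.mpr
        ⟨Finset.mem_image_of_mem U hTT1.1, Finset.mem_image_of_mem U hTT1.2⟩, ?_⟩
      have hsubadd : U T - U T' = U T + U T' := by
        funext i
        exact CharTwo.sub_eq_add _ _
      simpa [hΨ, hsubadd] using hTT2
    have hScard : (S.card : ℝ) ≤ Tm := by
      have := Finset.card_image_le (s := range Tm) (f := U)
      rw [Finset.card_range] at this
      exact_mod_cast this
    calc (bad.card : ℝ) = ((bad.image Ψ).card : ℝ) := by rw [Finset.card_image_of_injOn hinj]
      _ ≤ ((S ×ˢ S).filter (fun xy =>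
          ((Finset.univ.filter fun i : Fin c => (Bc.mulVec (xy.1 - xy.2)) i ≠ 0).card < w))).card := by
          exact_mod_cast Finset.card_le_card hsub
      _ ≤ S.card * ((w * Bc.rank + 1 : ℕ) : ℝ) ^ w * (2 : ℝ) ^ (d - Bc.rank) := hCountc S
      _ ≤ Tm * ((w * Bc.rank + 1 : ℕ) : ℝ) ^ w * (2 : ℝ) ^ (d - Bc.rank) := by gcongr
  -- sum over pairs of |K|
  have hsumK : ∑ T ∈ range Tm, ∑ T' ∈ range Tm, |K (U T + U T') (V T + V T')| ≤
      (Tm : ℝ) ^ 2 * (δ * (2 : ℝ) ^ c) +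
        Tm * ((w * Bc.rank + 1 : ℕ) : ℝ) ^ w * (2 : ℝ) ^ (d - Bc.rank) * (2 : ℝ) ^ c := by
    have hPsum : ∑ T ∈ range Tm, ∑ T' ∈ range Tm, |K (U T + U T') (V T + V T')| =
        ∑ TT ∈ Pairs, |K (U TT.1 + U TT.2) (V TT.1 + V TT.2)| := by
      rw [hPairs, Finset.sum_product]
    rw [hPsum, ← Finset.sum_filter_add_sum_filter_not Pairs
      (fun TT : ℕ × ℕ => (Aset (U TT.1 + U TT.2)).card < w)]
    have hb1 : ∑ TT ∈ bad, |K (U TT.1 + U TT.2) (V TT.1 + V TT.2)| ≤ bad.card * (2 : ℝ) ^ c := by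
      refine (Finset.sum_le_sum fun TT _ => hKtriv _ _).trans ?_
      simp
    have hg1 : ∑ TT ∈ Pairs.filter (fun TT : ℕ × ℕ => ¬ (Aset (U TT.1 + U TT.2)).card < w),
        |K (U TT.1 + U TT.2) (V TT.1 + V TT.2)| ≤ (Tm : ℝ) ^ 2 * (δ * (2 : ℝ) ^ c) := by
      refine (Finset.sum_le_sum fun TT hTT =>
        hKgood _ _ (not_lt.mp (Finset.mem_filter.mp hTT).2)).trans ?_
      rw [Finset.sum_const, nsmul_eq_mul]
      have hcard : ((Pairs.filter (fun TT : ℕ × ℕ => ¬ (Aset (U TT.1 + U TT.2)).card < w)).card : ℝ) ≤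
          (Tm : ℝ) ^ 2 := by
        have h1 := Finset.card_filter_le Pairs (fun TT : ℕ × ℕ => ¬ (Aset (U TT.1 + U TT.2)).card < w)
        rw [hPairs, Finset.card_product, Finset.card_range] at h1
        have h2 : ((Pairs.filter (fun TT : ℕ × ℕ => ¬ (Aset (U TT.1 + U TT.2)).card < w)).card : ℝ) ≤
            ((Tm * Tm : ℕ) : ℝ) := by exact_mod_cast h1
        simpa [sq] using h2
      have hδc : 0 ≤ δ * (2 : ℝ) ^ c := by positivity
      exact mul_le_mul_of_nonneg_right hcard hδc
    have h2c : (0 : ℝ) ≤ (2 : ℝ) ^ c := by positivity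
    calc _ ≤ bad.card * (2 : ℝ) ^ c + (Tm : ℝ) ^ 2 * (δ * (2 : ℝ) ^ c) := add_le_add hb1 hg1
      _ ≤ _ := by nlinarith [hbadcard]
  -- assemble
  have hsq : ∑ T₀ ∈ I, g T₀ ^ 2 ≤ (2 : ℝ) ^ c * ((Tm : ℝ) ^ 2 * δ +
      Tm * ((w * Bc.rank + 1 : ℕ) : ℝ) ^ w * (2 : ℝ) ^ (d - Bc.rank)) := by
    rw [hexpand]
    calc ∑ T ∈ range Tm, ∑ T' ∈ range Tm, s T * s T' * K (U T + U T') (V T + V T')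
        ≤ ∑ T ∈ range Tm, ∑ T' ∈ range Tm, |K (U T + U T') (V T + V T')| := by
          refine Finset.sum_le_sum fun T _ => Finset.sum_le_sum fun T' _ => ?_
          have h1 : |s T * s T'| ≤ 1 := by
            rw [abs_mul]
            nlinarith [hs T, hs T', abs_nonneg (s T), abs_nonneg (s T')]
          calc s T * s T' * K (U T + U T') (V T + V T')
              ≤ |s T * s T' * K (U T + U T') (V T + V T')| := le_abs_self _
            _ = |s T * s T'| * |K (U T + U T') (V T + V T')| := abs_mul _ _
            _ ≤ 1 * |K (U T + U T') (V T + V T')| :=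
                mul_le_mul_of_nonneg_right h1 (abs_nonneg _)
            _ = _ := one_mul _
      _ ≤ _ := hsumK
      _ = _ := by ring
  calc (∑ T₀ ∈ I, |g T₀|) ^ 2 ≤ (I.card : ℝ) * ∑ T₀ ∈ I, g T₀ ^ 2 := sq_sum_abs_le I g
    _ ≤ (2 : ℝ) ^ c * ∑ T₀ ∈ I, g T₀ ^ 2 :=
        mul_le_mul_of_nonneg_right hIcard (Finset.sum_nonneg fun _ _ => sq_nonneg _)
    _ ≤ _ := mul_le_mul_of_nonneg_left hsq (by positivity)

end Summit.QuantumAdvantage.QuantumAdvantage.Theorems.MobiusLadderQuadraticDigitPhasesStubOneCutKatai
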